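import Literature.AlgebraicGeometry.HodgeTheory.CMHodgeGroupCentreWeil
import Literature.Algebra.Lie.IrreducibleLinearLieAlgebraPlane
import HarnessLib

/-!
# The derived algebra of an admissible `𝔤 ⊆ 𝔲_E(V,ψ)` for a CM field `E = ℚ[φ]`: dimension bound, tracelessness,
# projections onto `𝔰𝔩(W_σ)`, and the vanishing of rational elements supported on the `Θ`-scalar places
# (Moonen–Zarhin 1999 §2 (2.3); Ribet 1983 §3; Deligne LNM 900 I §3)

Family `hodge`, layer `Literature/AlgebraicGeometry/HodgeTheory` (brick P3-prep of the design note
`HOME/jobs/A7-inventory-eng5g6/DESIGN-rows10-12-allmembers.md` of the cell `pub-hodgeav-hg6`, req-37 (A) Q2b, TABLE X rows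
10 / 12 ALL MEMBERS; continues `CMHodgeGroupCentre*`). UNCONDITIONAL; theorems only, no definition, no named fact, no `sorry`.
HONEST FRAMING of that cell: HC / HC_AV / HC_CM / H2 NOT proved — linear algebra of polarized weight-one Hodge structures.

SETTING as in `CMThetaSocket.*` / `CMThetaCentre.*`: `H` effective of weight `1`, `ψ`, `E = End_Hdg(V) = ℚ[φ]`, CM type
`μ : ι → ℂ`, blocks `W_k = ker(φ_ℂ − μ k)` of dimension `n₀`, an admissible `𝔤` (commutes with `E`, `ψ`-skew), `Θ ∈ 𝔤_ℂ`.
The RATIONAL DERIVED SPAN is `𝔡 = span_ℚ {XX′ − X′X : X, X′ ∈ 𝔤}` (written out; `spanC 𝔡` is spanned by the commutators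
of `𝔤_ℂ`, `commutator_mem_spanC_derived`).
* §1 `CMDerived.finrank_le_of_traceless` — a complex subspace of `φ_ℂ`-commuting `ψ_ℂ`-skew operators traceless on every
  `W_k` has dimension `≤ |ι| (n₀² − 1)` (restriction to `⊕_k 𝔰𝔩(W_k)` is injective, `CMThetaSocket.eq_zero_of_forall_eigenspace`).
* §2 `CMDerived.trace_restrict_eq_zero` — elements of `(𝔡)_ℂ` are traceless on every `𝔤`-stable subspace;
  `CMDerived.finrank_sup_map_mulLeft_le` — for a `ψ`-SYMMETRIC `b ∈ E`, `dim_ℚ (𝔡 + b𝔡) ≤ |ι|(n₀² − 1)` (both summands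
  complexify into the space of §1).
* §3 `CMDerived.exists_mem_spanC_derived_forall_eq` (`n₀ = 2`) — if every `W_k` is `𝔤`-irreducible, every traceless
  endomorphism of `W_k` is the restriction of an element of `(𝔡)_ℂ` (the tree's relative plane theorem
  `Literature.Algebra.Lie.exists_mem_forall_eq_of_trace_eq_zero` gives it in `𝔤_ℂ`; `Z = [h, ½(αe − βf)] + [γe, f]` for an
  `𝔰𝔩₂`-triple moves it into the derived span).
* §4 **`CMDerived.eq_zero_of_forall_balanced`** — a RATIONAL `X ∈ 𝔡` whose complexification kills `W_k` for every BALANCED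
  place (`W_k` meets both `V^{1,0}` and `V^{0,1}`) vanishes: `X_ℂ` commutes with `Θ` (`Θ` is scalar on the other blocks), so
  `X ∈ E` (`mem_endAlg_of_commute_theta`), so `X` commutes with `𝔤`, so `X_ℂ|_{W_k}` is a scalar (irreducibility) of trace `0`.
  This is the arithmetic input «a simple ideal of `Hg_ℂ^{der}` living on CM-scalar places is rational only if zero» of the
  no-twist step.

## References
* [MoonenZarhin1999LowDim] B. Moonen, Yu. Zarhin, Math. Ann. 315 (1999), §2 (2.3).
* [Ribet1983] K. A. Ribet, Amer. J. Math. 105 (1983), §3 (the Lie algebra lemma and its use).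
* [Deligne1982HodgeCycles] P. Deligne, LNM 900 (1982), I §3 (proof of Prop. 3.4), §4 (p. 30).
* [Humphreys1972] J. E. Humphreys, GTM 9, §4.1 (Lie's theorem), §2.1 (`𝔰𝔩₂`).
-/

noncomputable section

open scoped TensorProduct
open Module

namespace Literature.AlgebraicGeometry.Motives

namespace HodgeStructure

universe u

variable {V : Type u} [AddCommGroup V] [Module ℚ V] {n : ℤ}

/-- A rational operator with zero complexification is zero. [folklore] -/
private theorem CMDerived.eq_zero_of_baseChange [Module.Finite ℚ V] {X : Module.End ℚ V} (hX : X.baseChange ℂ = 0) :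
    X = 0 := by
  have h : X ∈ (⊥ : Submodule ℚ (Module.End ℚ V)) :=
    mem_of_baseChange_mem_spanC ⊥ (by rw [hX]; exact Submodule.zero_mem _)
  exact (Submodule.mem_bot ℚ).1 h

/-! ### §1 The dimension bound `dim ≤ |ι| (n₀² − 1)` -/

/-- **A complex space of `φ_ℂ`-commuting `ψ_ℂ`-skew operators traceless on every `W_{μ k}` has dimension
`≤ |ι|(n₀² − 1)`**: restriction to `⊕_k 𝔰𝔩(W_{μ k})` is injective (`CMThetaSocket.eq_zero_of_forall_eigenspace`) and
`dim 𝔰𝔩(W) = n₀² − 1`. («`𝔰𝔲_E(V,ψ)_ℂ ≅ ∏_σ 𝔰𝔩(W_σ)`».) [cite: MoonenZarhin1999LowDim, §2 (2.3)]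
[cite: Deligne1982HodgeCycles, §4 (p. 30)] -/
theorem CMDerived.finrank_le_of_traceless [Module.Finite ℚ V] [HodgeTensorFacts.{u, u}] {ι : Type} [Fintype ι]
    [DecidableEq ι] (H : HodgeStructure V n) (hn : n = 1) (heff : H.IsEffective) (ψ : H.Polarization)
    {φ : Module.End ℚ V} (hφE : φ ∈ H.endAlg) {m : ℕ} (hE : ∀ a ∈ H.endAlg, ∃ q : Fin m → ℚ, a = ∑ k, q k • φ ^ (k : ℕ))
    (μ : ι → ℂ) (hinj : Function.Injective μ) (hdist : ∀ k k', μ k' ≠ starRingEnd ℂ (μ k)) {n₀ : ℕ} (hn₀ : n₀ ≠ 0)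
    (hrank : ∀ k, Module.finrank ℂ ↥(Module.End.eigenspace (φ.baseChange ℂ) (μ k) ⊓ H.piece 1 0) +
      Module.finrank ℂ ↥(Module.End.eigenspace (φ.baseChange ℂ) (μ k) ⊓ H.piece 0 1) = n₀)
    (htop : (⨆ kt : ι × Fin 2, Module.End.eigenspace (φ.baseChange ℂ)
      (if kt.2 = 0 then μ kt.1 else starRingEnd ℂ (μ kt.1))) = ⊤)
    (S : Submodule ℂ (Module.End ℂ (ℂ ⊗[ℚ] V)))
    (hSφ : ∀ Y ∈ S, Y * φ.baseChange ℂ = φ.baseChange ℂ * Y)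
    (hSskew : ∀ Y ∈ S, ∀ x y, ψ.form.baseChange ℂ (Y x) y + ψ.form.baseChange ℂ x (Y y) = 0)
    (hSW : ∀ Y ∈ S, ∀ k, ∀ w ∈ Module.End.eigenspace (φ.baseChange ℂ) (μ k),
      Y w ∈ Module.End.eigenspace (φ.baseChange ℂ) (μ k))
    (hStr : ∀ Y (hY : Y ∈ S) k, LinearMap.trace ℂ _ (Y.restrict (hSW Y hY k)) = 0) :
    Module.finrank ℂ S ≤ Fintype.card ι * (n₀ ^ 2 - 1) := by
  classical
  set F := φ.baseChange ℂ with hF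
  obtain ⟨cb, κ, hcbW, -, -, -, -, -⟩ := CMTheta.exists_adaptedDualBasis H hn heff ψ hφE hE μ hinj hdist hrank htop
  have hfin : ∀ k, Module.finrank ℂ ↥(Module.End.eigenspace F (μ k)) = n₀ := fun k => by
    rw [hF, CMTheta.finrank_eigenspace_eq_add H hn heff hφE, hrank k]
  have he0 : ∀ k : ι, Function.Injective (fun j : Fin n₀ => (((k, (0 : Fin 2)), j) : (ι × Fin 2) × Fin n₀)) :=
    fun k j j' h => by simpa using h
  have hWspan : ∀ k, Module.End.eigenspace F (μ k) =
      Submodule.span ℂ (Set.range (cb ∘ fun j : Fin n₀ => ((k, (0 : Fin 2)), j))) :=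
    fun k => CMArith.eq_span_of_basis cb _ (he0 k) _ (hcbW k) (hfin k)
  -- coordinates of `Y cb_{(k,0),j}` along `cb_{(k,0),i}`
  let ρ : S →ₗ[ℂ] (ι → Fin n₀ → Fin n₀ → ℂ) :=
    { toFun := fun Y k i j => cb.repr ((Y : Module.End ℂ (ℂ ⊗[ℚ] V)) (cb ((k, 0), j))) ((k, 0), i)
      map_add' := fun Y Y' => by
        funext k i j
        simp only [Submodule.coe_add, LinearMap.add_apply, map_add, Finsupp.add_apply, Pi.add_apply]
      map_smul' := fun c Y => by
        funext k i j
        simp only [Submodule.coe_smul, LinearMap.smul_apply, map_smul, Finsupp.smul_apply, Pi.smul_apply,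
          RingHom.id_apply] }
  have hρ : ∀ (Y : S) k i j, ρ Y k i j = cb.repr ((Y : Module.End ℂ (ℂ ⊗[ℚ] V)) (cb ((k, 0), j))) ((k, 0), i) :=
    fun Y k i j => rfl
  have hρinj : Function.Injective ρ := by
    intro Y Y' hYY'
    rw [Subtype.ext_iff, ← sub_eq_zero]
    have hD : ((Y : Module.End ℂ (ℂ ⊗[ℚ] V)) - Y') ∈ S := S.sub_mem Y.2 Y'.2
    refine CMThetaSocket.eq_zero_of_forall_eigenspace H hn heff ψ hφE hE μ hinj hdist htop (hSφ _ hD)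
      (hSskew _ hD) fun k w hw => ?_
    -- `Y - Y'` kills the basis vectors `cb_{(k,0),j}`, hence `W_k`
    have hbasis : ∀ j, ((Y : Module.End ℂ (ℂ ⊗[ℚ] V)) - Y') (cb ((k, 0), j)) = 0 := by
      intro j
      refine cb.ext_elem fun idx => ?_
      rw [map_zero, Finsupp.zero_apply]
      obtain ⟨⟨k', t⟩, i⟩ := idx
      by_cases h : k' = k ∧ t = 0
      · obtain ⟨rfl, rfl⟩ := h
        have h1 := congrFun (congrFun (congrFun hYY' k') i) j
        rw [hρ, hρ] at h1
        rw [LinearMap.sub_apply, map_sub, Finsupp.sub_apply, h1, sub_self]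
      · refine CMArith.repr_eq_zero_of_mem_span cb _ (by rw [← hWspan k]; exact hSW _ hD k _ (hcbW k j)) ?_
        intro a ha
        simp only [Prod.mk.injEq] at ha
        exact h ⟨ha.1.1.symm, ha.1.2.symm⟩
    rw [hWspan k] at hw
    obtain ⟨c, rfl⟩ := (Submodule.mem_span_range_iff_exists_fun ℂ).1 hw
    rw [map_sum]
    exact Finset.sum_eq_zero fun j _ => by rw [map_smul, Function.comp_apply, hbasis j, smul_zero]
  -- the block traces vanish: the image lies in the kernel of `τ`
  let τ : (ι → Fin n₀ → Fin n₀ → ℂ) →ₗ[ℂ] (ι → ℂ) :=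
    { toFun := fun f k => ∑ i, f k i i
      map_add' := fun f g => by funext k; simp only [Pi.add_apply, Finset.sum_add_distrib]
      map_smul' := fun c f => by funext k; simp only [Pi.smul_apply, smul_eq_mul, Finset.mul_sum, RingHom.id_apply] }
  have hτ : ∀ f k, τ f k = ∑ i, f k i i := fun f k => rfl
  have hrange : LinearMap.range ρ ≤ LinearMap.ker τ := by
    rintro _ ⟨Y, rfl⟩
    rw [LinearMap.mem_ker]
    funext k
    rw [hτ, Pi.zero_apply]
    simp_rw [hρ]
    rw [← CMArith.trace_restrict_eq_sum_repr cb _ (he0 k) _ (hcbW k) (hfin k) _ (hSW Y Y.2 k)]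
    exact hStr Y Y.2 k
  have hτsurj : LinearMap.range τ = ⊤ := by
    rw [eq_top_iff]
    rintro g -
    refine ⟨fun k i j => if i = ⟨0, Nat.pos_of_ne_zero hn₀⟩ ∧ j = ⟨0, Nat.pos_of_ne_zero hn₀⟩ then g k else 0, ?_⟩
    funext k
    rw [hτ, Finset.sum_eq_single ⟨0, Nat.pos_of_ne_zero hn₀⟩ (fun i _ hi => by rw [if_neg (fun h => hi h.1)])
      (fun h => absurd (Finset.mem_univ _) h), if_pos ⟨rfl, rfl⟩]
  have hker : Module.finrank ℂ ↥(LinearMap.ker τ) = Fintype.card ι * (n₀ ^ 2 - 1) := by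
    have h := LinearMap.finrank_range_add_finrank_ker τ
    rw [hτsurj, finrank_top, Module.finrank_fintype_fun_eq_card, Module.finrank_pi_fintype] at h
    simp only [Module.finrank_pi_fintype, Module.finrank_self, Fintype.card_fin, Finset.sum_const, Finset.card_univ,
      smul_eq_mul, mul_one] at h
    have h' : Module.finrank ℂ ↥(LinearMap.ker τ) = Fintype.card ι * (n₀ * n₀) - Fintype.card ι := by omega
    rw [h', sq, Nat.mul_sub_one]
  calc Module.finrank ℂ S = Module.finrank ℂ ↥(LinearMap.range ρ) := (LinearMap.finrank_range_of_inj hρinj).symm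
    _ ≤ Module.finrank ℂ ↥(LinearMap.ker τ) := Submodule.finrank_mono hrange
    _ = Fintype.card ι * (n₀ ^ 2 - 1) := hker
/-! ### §2 The rational derived span: tracelessness and the dimension of `𝔡 + b𝔡` -/

/-- Restriction is additive (plumbing). [folklore] -/
private theorem CMDerived.restrict_add {K M : Type*} [CommRing K] [AddCommGroup M] [Module K M] {W : Submodule K M}
    {Y Y' : Module.End K M} (hY : ∀ w ∈ W, Y w ∈ W) (hY' : ∀ w ∈ W, Y' w ∈ W) (h : ∀ w ∈ W, (Y + Y') w ∈ W) :
    (Y + Y').restrict h = Y.restrict hY + Y'.restrict hY' :=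
  LinearMap.ext fun w => Subtype.ext (by
    simp only [LinearMap.coe_restrict_apply, LinearMap.add_apply, Submodule.coe_add])

/-- Restriction is homogeneous (plumbing). [folklore] -/
private theorem CMDerived.restrict_smul {K M : Type*} [CommRing K] [AddCommGroup M] [Module K M] {W : Submodule K M}
    {Y : Module.End K M} (c : K) (hY : ∀ w ∈ W, Y w ∈ W) (h : ∀ w ∈ W, (c • Y) w ∈ W) :
    (c • Y).restrict h = c • Y.restrict hY :=
  LinearMap.ext fun w => Subtype.ext (by
    simp only [LinearMap.coe_restrict_apply, LinearMap.smul_apply, Submodule.coe_smul])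

/-- Restriction is multiplicative (plumbing). [folklore] -/
private theorem CMDerived.restrict_mul {K M : Type*} [CommRing K] [AddCommGroup M] [Module K M] {W : Submodule K M}
    {Y Y' : Module.End K M} (hY : ∀ w ∈ W, Y w ∈ W) (hY' : ∀ w ∈ W, Y' w ∈ W) (h : ∀ w ∈ W, (Y * Y') w ∈ W) :
    (Y * Y').restrict h = Y.restrict hY * Y'.restrict hY' :=
  LinearMap.ext fun w => Subtype.ext (by
    simp only [LinearMap.coe_restrict_apply, Module.End.mul_apply])

/-- Traces of commutators vanish (plumbing, stated for a module TYPE to fix the instance path). [folklore] -/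
private theorem CMDerived.trace_commutator {K M : Type*} [CommRing K] [AddCommGroup M] [Module K M]
    (A B : Module.End K M) : LinearMap.trace K M (A * B - B * A) = 0 := by
  rw [map_sub, LinearMap.trace_mul_comm, sub_self]

/-- **`𝔡 ⊆ 𝔤`** for a bracket-closed `𝔤`. [cite: Deligne1982HodgeCycles, I §3 (proof of Prop. 3.4)] -/
theorem CMDerived.derived_le {𝔤 : Submodule ℚ (Module.End ℚ V)} (hbr : ∀ X ∈ 𝔤, ∀ X' ∈ 𝔤, X * X' - X' * X ∈ 𝔤) :
    Submodule.span ℚ {B | ∃ X ∈ 𝔤, ∃ X' ∈ 𝔤, X * X' - X' * X = B} ≤ 𝔤 :=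
  Submodule.span_le.2 (by rintro _ ⟨X, hX, X', hX', rfl⟩; exact hbr X hX X' hX')

/-- **Elements of the complex derived span are traceless on every `𝔤`-stable subspace** (commutators have traceless
restrictions). [cite: Humphreys1972, §4.3 (trace of a commutator)] [cite: Deligne1982HodgeCycles, I §3 (proof of Prop. 3.4)] -/
theorem CMDerived.trace_restrict_eq_zero [Module.Finite ℚ V] {𝔤 : Submodule ℚ (Module.End ℚ V)}
    {W : Submodule ℂ (ℂ ⊗[ℚ] V)} (hW : ∀ X ∈ 𝔤, ∀ w ∈ W, X.baseChange ℂ w ∈ W) {Y : Module.End ℂ (ℂ ⊗[ℚ] V)}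
    (hY : Y ∈ spanC (Submodule.span ℚ {B | ∃ X ∈ 𝔤, ∃ X' ∈ 𝔤, X * X' - X' * X = B}))
    (hYW : ∀ w ∈ W, Y w ∈ W) : LinearMap.trace ℂ W (Y.restrict hYW) = 0 := by
  -- `spanC` of a span is the span of the base changes of the generators
  have key : ∀ B ∈ Submodule.span ℚ {B | ∃ X ∈ 𝔤, ∃ X' ∈ 𝔤, X * X' - X' * X = B},
      B.baseChange ℂ ∈ Submodule.span ℂ ((fun B : Module.End ℚ V => B.baseChange ℂ) ''
        {B | ∃ X ∈ 𝔤, ∃ X' ∈ 𝔤, X * X' - X' * X = B}) := by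
    intro B hB
    induction hB using Submodule.span_induction with
    | mem B hB => exact Submodule.subset_span ⟨B, hB, rfl⟩
    | zero => rw [LinearMap.baseChange_zero]; exact Submodule.zero_mem _
    | add B B' _ _ h h' => rw [LinearMap.baseChange_add]; exact Submodule.add_mem _ h h'
    | smul q B _ h =>
      rw [LinearMap.baseChange_smul]
      have e : q • (B.baseChange ℂ) = (q : ℂ) • B.baseChange ℂ := LinearMap.ext fun w => by
        rw [LinearMap.smul_apply, LinearMap.smul_apply, ← algebraMap_smul ℂ q (B.baseChange ℂ w), eq_ratCast]
      rw [e]; exact Submodule.smul_mem _ _ h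
  have hY' : Y ∈ Submodule.span ℂ ((fun B : Module.End ℚ V => B.baseChange ℂ) ''
      {B | ∃ X ∈ 𝔤, ∃ X' ∈ 𝔤, X * X' - X' * X = B}) := by
    unfold spanC at hY
    refine Submodule.span_le.2 ?_ hY
    rintro _ ⟨B, hB, rfl⟩
    exact key B hB
  suffices h : ∃ h : ∀ w ∈ W, Y w ∈ W, LinearMap.trace ℂ W (Y.restrict h) = 0 by
    obtain ⟨h, ht⟩ := h; exact ht
  clear hYW hY
  induction hY' using Submodule.span_induction with
  | mem Y hYgen =>
    obtain ⟨_, ⟨X, hX, X', hX', rfl⟩, rfl⟩ := hYgen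
    have hXW := hW X hX
    have hX'W := hW X' hX'
    have hYW : ∀ w ∈ W, (X * X' - X' * X).baseChange ℂ w ∈ W := fun w hw => by
      rw [LinearMap.baseChange_sub, LinearMap.sub_apply, LinearMap.baseChange_mul, LinearMap.baseChange_mul]
      exact W.sub_mem (hXW _ (hX'W w hw)) (hX'W _ (hXW w hw))
    refine ⟨hYW, ?_⟩
    have hre : ((X * X' - X' * X).baseChange ℂ).restrict hYW =
        (X.baseChange ℂ).restrict hXW * (X'.baseChange ℂ).restrict hX'W -
          (X'.baseChange ℂ).restrict hX'W * (X.baseChange ℂ).restrict hXW := LinearMap.ext fun w => Subtype.ext (by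
      simp only [LinearMap.coe_restrict_apply, LinearMap.sub_apply, Module.End.mul_apply, Submodule.coe_sub,
        LinearMap.baseChange_sub, LinearMap.baseChange_mul])
    rw [hre]
    exact CMDerived.trace_commutator _ _
  | zero =>
    have h0 : ∀ w ∈ W, (0 : Module.End ℂ (ℂ ⊗[ℚ] V)) w ∈ W := fun w _ => by
      rw [LinearMap.zero_apply]; exact W.zero_mem
    refine ⟨h0, ?_⟩
    have : (0 : Module.End ℂ (ℂ ⊗[ℚ] V)).restrict h0 = 0 :=
      LinearMap.ext fun w => Subtype.ext (by
        simp only [LinearMap.coe_restrict_apply, LinearMap.zero_apply, Submodule.coe_zero])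
    rw [this, map_zero]
  | add Y Y' _ _ h h' =>
    obtain ⟨hYW₁, h₁⟩ := h
    obtain ⟨hYW₂, h₂⟩ := h'
    have hYW : ∀ w ∈ W, (Y + Y') w ∈ W := fun w hw => W.add_mem (hYW₁ w hw) (hYW₂ w hw)
    exact ⟨hYW, by rw [CMDerived.restrict_add hYW₁ hYW₂ hYW, map_add, h₁, h₂, add_zero]⟩
  | smul c Y _ h =>
    obtain ⟨hYW₁, h₁⟩ := h
    have hYW : ∀ w ∈ W, (c • Y) w ∈ W := fun w hw => W.smul_mem c (hYW₁ w hw)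
    exact ⟨hYW, by rw [CMDerived.restrict_smul c hYW₁ hYW, map_smul, h₁, smul_zero]⟩

/-- **`dim_ℚ (𝔡 + b𝔡) ≤ |ι|(n₀² − 1)`** for a `ψ`-symmetric `b ∈ E`: both `𝔡` and `b𝔡` consist of operators commuting with
`E`, `ψ`-skew (`b` symmetric commuting with a skew `X` makes `bX` skew) and traceless on every `W_{μ k}` (`b` is a scalar
there), so their complex span falls under `finrank_le_of_traceless`, and `dim_ℚ = dim_ℂ spanC` (`finrank_spanC_eq`).
[cite: MoonenZarhin1999LowDim, §2 (2.3)] [cite: Deligne1982HodgeCycles, I §3 (proof of Prop. 3.4)] -/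
theorem CMDerived.finrank_sup_map_mulLeft_le [Module.Finite ℚ V] [HodgeTensorFacts.{u, u}] {ι : Type} [Fintype ι]
    [DecidableEq ι] (H : HodgeStructure V n) (hn : n = 1) (heff : H.IsEffective) (ψ : H.Polarization)
    {φ : Module.End ℚ V} (hφE : φ ∈ H.endAlg) {m : ℕ} (hE : ∀ a ∈ H.endAlg, ∃ q : Fin m → ℚ, a = ∑ k, q k • φ ^ (k : ℕ))
    (μ : ι → ℂ) (hinj : Function.Injective μ) (hdist : ∀ k k', μ k' ≠ starRingEnd ℂ (μ k)) {n₀ : ℕ} (hn₀ : n₀ ≠ 0)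
    (hrank : ∀ k, Module.finrank ℂ ↥(Module.End.eigenspace (φ.baseChange ℂ) (μ k) ⊓ H.piece 1 0) +
      Module.finrank ℂ ↥(Module.End.eigenspace (φ.baseChange ℂ) (μ k) ⊓ H.piece 0 1) = n₀)
    (htop : (⨆ kt : ι × Fin 2, Module.End.eigenspace (φ.baseChange ℂ)
      (if kt.2 = 0 then μ kt.1 else starRingEnd ℂ (μ kt.1))) = ⊤)
    (𝔤 : Submodule ℚ (Module.End ℚ V)) (hbr : ∀ X ∈ 𝔤, ∀ X' ∈ 𝔤, X * X' - X' * X ∈ 𝔤)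
    (hcomm : ∀ X ∈ 𝔤, ∀ a : H.endAlg, X * (a : Module.End ℚ V) = (a : Module.End ℚ V) * X)
    (hskew : ∀ X ∈ 𝔤, ∀ v w, ψ.form (X v) w + ψ.form v (X w) = 0)
    {b : Module.End ℚ V} (hbE : b ∈ H.endAlg) (hbsym : ∀ v w, ψ.form (b v) w = ψ.form v (b w)) :
    Module.finrank ℚ ↥(Submodule.span ℚ {B | ∃ X ∈ 𝔤, ∃ X' ∈ 𝔤, X * X' - X' * X = B} ⊔
      (Submodule.span ℚ {B | ∃ X ∈ 𝔤, ∃ X' ∈ 𝔤, X * X' - X' * X = B}).map (LinearMap.mulLeft ℚ b)) ≤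
      Fintype.card ι * (n₀ ^ 2 - 1) := by
  classical
  set 𝔡 := Submodule.span ℚ {B | ∃ X ∈ 𝔤, ∃ X' ∈ 𝔤, X * X' - X' * X = B} with h𝔡def
  set 𝔞 := 𝔡 ⊔ 𝔡.map (LinearMap.mulLeft ℚ b) with h𝔞def
  set F := φ.baseChange ℂ with hF
  have h𝔡𝔤 : 𝔡 ≤ 𝔤 := CMDerived.derived_le hbr
  have hEcomm : ∀ a ∈ H.endAlg, ∀ a' ∈ H.endAlg, a * a' = a' * a := fun a ha a' ha' =>
    CMThetaCentre.mul_comm_of_hE H hE ha ha'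
  have hdec : ∀ X ∈ 𝔞, ∃ X₁ ∈ 𝔡, ∃ X₂ ∈ 𝔡, X = X₁ + b * X₂ := fun X hX => by
    obtain ⟨X₁, hX₁, Y, hY, rfl⟩ := Submodule.mem_sup.1 hX
    obtain ⟨X₂, hX₂, rfl⟩ := Submodule.mem_map.1 hY
    exact ⟨X₁, hX₁, X₂, hX₂, by rw [LinearMap.mulLeft_apply]⟩
  -- `𝔞` is admissible: it commutes with `E` and is `ψ`-skew
  have h𝔞comm : ∀ X ∈ 𝔞, ∀ a : H.endAlg, X * (a : Module.End ℚ V) = (a : Module.End ℚ V) * X := by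
    intro X hX a
    obtain ⟨X₁, hX₁, X₂, hX₂, rfl⟩ := hdec X hX
    rw [add_mul, mul_add, hcomm X₁ (h𝔡𝔤 hX₁) a, mul_assoc, hcomm X₂ (h𝔡𝔤 hX₂) a, ← mul_assoc,
      hEcomm b hbE a a.2, mul_assoc]
  have h𝔞skew : ∀ X ∈ 𝔞, ∀ v w, ψ.form (X v) w + ψ.form v (X w) = 0 := by
    intro X hX v w
    obtain ⟨X₁, hX₁, X₂, hX₂, rfl⟩ := hdec X hX
    have hbX₂ : X₂ * b = b * X₂ := hcomm X₂ (h𝔡𝔤 hX₂) ⟨b, hbE⟩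
    rw [LinearMap.add_apply, LinearMap.add_apply, map_add, LinearMap.add_apply, map_add, Module.End.mul_apply,
      ← hbX₂, Module.End.mul_apply, hbsym]
    have h1 := hskew X₁ (h𝔡𝔤 hX₁) v w
    have h2 := hskew X₂ (h𝔡𝔤 hX₂) v (b w)
    linear_combination h1 + h2
  -- its complex span: commuting with `φ_ℂ`, skew, block-stable, traceless on the blocks
  have hSφ : ∀ Y ∈ spanC 𝔞, Y * F = F * Y := fun Y hY => UnitaryTheta.commute_of_mem_spanC H hφE h𝔞comm hY
  have hSskew : ∀ Y ∈ spanC 𝔞, ∀ x y, ψ.form.baseChange ℂ (Y x) y + ψ.form.baseChange ℂ x (Y y) = 0 :=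
    fun Y hY => ThetaSubalgebra.formBaseChange_add_eq_zero_of_mem_spanC ψ h𝔞skew hY
  have hSW : ∀ Y ∈ spanC 𝔞, ∀ k, ∀ w ∈ Module.End.eigenspace F (μ k), Y w ∈ Module.End.eigenspace F (μ k) :=
    fun Y hY k w hw => UnitaryTheta.apply_mem_eigenspace_of_commute (hSφ Y hY) hw
  have hXW : ∀ X ∈ 𝔤, ∀ k, ∀ w ∈ Module.End.eigenspace F (μ k), X.baseChange ℂ w ∈ Module.End.eigenspace F (μ k) :=
    fun X hX k w hw => UnitaryTheta.apply_mem_eigenspace_of_commute (UnitaryTheta.baseChange_commute H hφE hcomm hX) hw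
  have hbW : ∀ k, ∀ w ∈ Module.End.eigenspace F (μ k), b.baseChange ℂ w ∈ Module.End.eigenspace F (μ k) := by
    intro k w hw
    have hbφ : b.baseChange ℂ * F = F * b.baseChange ℂ := by
      rw [hF, ← LinearMap.baseChange_mul, hEcomm b hbE φ hφE, LinearMap.baseChange_mul]
    exact UnitaryTheta.apply_mem_eigenspace_of_commute hbφ hw
  have hStr : ∀ Y (hY : Y ∈ spanC 𝔞) k, LinearMap.trace ℂ _ (Y.restrict (hSW Y hY k)) = 0 := by
    intro Y hY k
    set W := Module.End.eigenspace F (μ k) with hWdef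
    obtain ⟨τ, hτ⟩ := CMTheta.exists_smul_of_mem_endAlg H hE hbE (μ k)
    suffices h : ∃ h : ∀ w ∈ W, Y w ∈ W, LinearMap.trace ℂ W (Y.restrict h) = 0 by
      obtain ⟨h, ht⟩ := h; exact ht
    unfold spanC at hY
    induction hY using Submodule.span_induction with
    | mem Y hYgen =>
      obtain ⟨X, hX, rfl⟩ := hYgen
      obtain ⟨X₁, hX₁, X₂, hX₂, rfl⟩ := hdec X hX
      have h₁ := hXW X₁ (h𝔡𝔤 hX₁) k
      have h₂ := hXW X₂ (h𝔡𝔤 hX₂) k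
      have hb₂ : ∀ w ∈ W, (b.baseChange ℂ * X₂.baseChange ℂ) w ∈ W := fun w hw => hbW k _ (h₂ w hw)
      have hsum : ∀ w ∈ W, (X₁ + b * X₂).baseChange ℂ w ∈ W := fun w hw => by
        rw [LinearMap.baseChange_add, LinearMap.baseChange_mul, LinearMap.add_apply]
        exact W.add_mem (h₁ w hw) (hb₂ w hw)
      refine ⟨hsum, ?_⟩
      have hre : ((X₁ + b * X₂).baseChange ℂ).restrict hsum =
          (X₁.baseChange ℂ).restrict h₁ + τ • (X₂.baseChange ℂ).restrict h₂ := LinearMap.ext fun w => Subtype.ext (by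
        simp only [LinearMap.coe_restrict_apply, LinearMap.add_apply, LinearMap.smul_apply, Submodule.coe_add,
          Submodule.coe_smul, LinearMap.baseChange_add, LinearMap.baseChange_mul, Module.End.mul_apply]
        rw [hτ _ (h₂ w w.2)])
      rw [hre, map_add, map_smul, CMDerived.trace_restrict_eq_zero (hXW · · k) (baseChange_mem_spanC hX₁) h₁,
        CMDerived.trace_restrict_eq_zero (hXW · · k) (baseChange_mem_spanC hX₂) h₂, smul_zero, add_zero]
    | zero =>
      have h0 : ∀ w ∈ W, (0 : Module.End ℂ (ℂ ⊗[ℚ] V)) w ∈ W := fun w _ => by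
        rw [LinearMap.zero_apply]; exact W.zero_mem
      refine ⟨h0, ?_⟩
      have : (0 : Module.End ℂ (ℂ ⊗[ℚ] V)).restrict h0 = 0 :=
        LinearMap.ext fun w => Subtype.ext (by
          simp only [LinearMap.coe_restrict_apply, LinearMap.zero_apply, Submodule.coe_zero])
      rw [this, map_zero]
    | add Y Y' _ _ h h' =>
      obtain ⟨hYW₁, h₁⟩ := h
      obtain ⟨hYW₂, h₂⟩ := h'
      have hYW : ∀ w ∈ W, (Y + Y') w ∈ W := fun w hw => W.add_mem (hYW₁ w hw) (hYW₂ w hw)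
      exact ⟨hYW, by rw [CMDerived.restrict_add hYW₁ hYW₂ hYW, map_add, h₁, h₂, add_zero]⟩
    | smul c Y _ h =>
      obtain ⟨hYW₁, h₁⟩ := h
      have hYW : ∀ w ∈ W, (c • Y) w ∈ W := fun w hw => W.smul_mem c (hYW₁ w hw)
      exact ⟨hYW, by rw [CMDerived.restrict_smul c hYW₁ hYW, map_smul, h₁, smul_zero]⟩
  rw [← finrank_spanC_eq 𝔞]
  exact CMDerived.finrank_le_of_traceless H hn heff ψ hφE hE μ hinj hdist hn₀ hrank htop (spanC 𝔞) hSφ hSskew hSW hStr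

/-! ### §4 A rational element of `𝔡` supported on the `Θ`-scalar places vanishes -/

/-- **A RATIONAL `X ∈ 𝔡` WHOSE COMPLEXIFICATION KILLS EVERY BALANCED BLOCK VANISHES** (see the module docstring): on an
unbalanced block `Θ` is `±1`, so `X_ℂ` commutes with `Θ` (determination on the `W_{μ k}`), hence `X ∈ End_Hdg(V) = E`
(`mem_endAlg_of_commute_theta`); then `X` commutes with `𝔤`, so on each `𝔤`-irreducible `W_{μ k}` the operator `X_ℂ` is
a scalar (an eigenspace is `𝔤`-stable), of trace `0` because `X ∈ 𝔡`: `X_ℂ = 0` on every `W_{μ k}`, so `X = 0`.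
[cite: MoonenZarhin1999LowDim, §2 (2.3)] [cite: Ribet1983, §3] [cite: Deligne1982HodgeCycles, I §3 (proof of Prop. 3.4)] -/
theorem CMDerived.eq_zero_of_forall_balanced [Module.Finite ℚ V] [HodgeTensorFacts.{u, u}] {ι : Type} [Fintype ι]
    [DecidableEq ι] (H : HodgeStructure V n) (hn : n = 1) (heff : H.IsEffective) (ψ : H.Polarization)
    {φ : Module.End ℚ V} (hφE : φ ∈ H.endAlg) {m : ℕ} (hE : ∀ a ∈ H.endAlg, ∃ q : Fin m → ℚ, a = ∑ k, q k • φ ^ (k : ℕ))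
    (μ : ι → ℂ) (hinj : Function.Injective μ) (hdist : ∀ k k', μ k' ≠ starRingEnd ℂ (μ k)) {n₀ : ℕ} (hn₀ : n₀ ≠ 0)
    (hrank : ∀ k, Module.finrank ℂ ↥(Module.End.eigenspace (φ.baseChange ℂ) (μ k) ⊓ H.piece 1 0) +
      Module.finrank ℂ ↥(Module.End.eigenspace (φ.baseChange ℂ) (μ k) ⊓ H.piece 0 1) = n₀)
    (htop : (⨆ kt : ι × Fin 2, Module.End.eigenspace (φ.baseChange ℂ)
      (if kt.2 = 0 then μ kt.1 else starRingEnd ℂ (μ kt.1))) = ⊤)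
    (𝔤 : Submodule ℚ (Module.End ℚ V)) (hbr : ∀ X ∈ 𝔤, ∀ X' ∈ 𝔤, X * X' - X' * X ∈ 𝔤)
    (hcomm : ∀ X ∈ 𝔤, ∀ a : H.endAlg, X * (a : Module.End ℚ V) = (a : Module.End ℚ V) * X)
    (hskew : ∀ X ∈ 𝔤, ∀ v w, ψ.form (X v) w + ψ.form v (X w) = 0)
    {Θ : Module.End ℂ (ℂ ⊗[ℚ] V)} (hΘ : ∀ p, ∀ x ∈ H.piece p (n - p), Θ x = ((2 * p - n : ℤ) : ℂ) • x)
    (hΘ𝔤 : Θ ∈ spanC 𝔤)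
    (hirr : ∀ k, ∀ U ≤ Module.End.eigenspace (φ.baseChange ℂ) (μ k),
      (∀ X ∈ 𝔤, ∀ u ∈ U, X.baseChange ℂ u ∈ U) → U = ⊥ ∨ U = Module.End.eigenspace (φ.baseChange ℂ) (μ k))
    {X : Module.End ℚ V} (hX : X ∈ Submodule.span ℚ {B | ∃ X ∈ 𝔤, ∃ X' ∈ 𝔤, X * X' - X' * X = B})
    (hX0 : ∀ k, Module.finrank ℂ ↥(Module.End.eigenspace (φ.baseChange ℂ) (μ k) ⊓ H.piece 1 0) ≠ 0 →
      Module.finrank ℂ ↥(Module.End.eigenspace (φ.baseChange ℂ) (μ k) ⊓ H.piece 0 1) ≠ 0 →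
      ∀ w ∈ Module.End.eigenspace (φ.baseChange ℂ) (μ k), X.baseChange ℂ w = 0) :
    X = 0 := by
  classical
  set F := φ.baseChange ℂ with hF
  set ψC := ψ.form.baseChange ℂ with hψC
  have h𝔡𝔤 := CMDerived.derived_le hbr
  have hX𝔤 : X ∈ 𝔤 := h𝔡𝔤 hX
  obtain ⟨-, -, hΘ10, hΘ01, -⟩ := UnitaryTheta.theta_facts H hn heff hΘ
  have hΘφ : Θ * F = F * Θ := UnitaryTheta.commute_of_mem_spanC H hφE hcomm hΘ𝔤
  have hΘskew := ThetaSubalgebra.formBaseChange_add_eq_zero_of_mem_spanC ψ hskew hΘ𝔤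
  have hΘW : ∀ k, ∀ w ∈ Module.End.eigenspace F (μ k), Θ w ∈ Module.End.eigenspace F (μ k) :=
    fun k w hw => UnitaryTheta.apply_mem_eigenspace_of_commute hΘφ hw
  have hYW : ∀ Y ∈ 𝔤, ∀ k, ∀ w ∈ Module.End.eigenspace F (μ k), Y.baseChange ℂ w ∈ Module.End.eigenspace F (μ k) :=
    fun Y hY k w hw => UnitaryTheta.apply_mem_eigenspace_of_commute (UnitaryTheta.baseChange_commute H hφE hcomm hY) hw
  have hXφ : X.baseChange ℂ * F = F * X.baseChange ℂ := UnitaryTheta.baseChange_commute H hφE hcomm hX𝔤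
  have hXskewC := ThetaSubalgebra.formBaseChange_add_eq_zero_of_skew ψ (hskew X hX𝔤)
  have hfin : ∀ k, Module.finrank ℂ ↥(Module.End.eigenspace F (μ k)) = n₀ := fun k => by
    rw [hF, CMTheta.finrank_eigenspace_eq_add H hn heff hφE, hrank k]
  subst hn
  -- on each block: `Θ` is a scalar, or `X_ℂ` vanishes
  have hblock : ∀ k, (∃ ε : ℂ, ∀ w ∈ Module.End.eigenspace F (μ k), Θ w = ε • w) ∨
      ∀ w ∈ Module.End.eigenspace F (μ k), X.baseChange ℂ w = 0 := by
    intro k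
    by_cases h10 : Module.finrank ℂ ↥(Module.End.eigenspace F (μ k) ⊓ H.piece 1 0) = 0
    · left
      refine ⟨-1, fun w hw => ?_⟩
      have hle : Module.End.eigenspace F (μ k) ⊓ H.piece 0 1 = Module.End.eigenspace F (μ k) :=
        Submodule.eq_of_le_of_finrank_eq inf_le_left (by have h := hrank k; rw [h10, zero_add] at h; rw [h, hfin])
      have hw01 : w ∈ H.piece 0 1 := by
        have : w ∈ Module.End.eigenspace F (μ k) ⊓ H.piece 0 1 := by rw [hle]; exact hw
        exact this.2
      rw [hΘ01 w hw01, neg_one_smul]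
    by_cases h01 : Module.finrank ℂ ↥(Module.End.eigenspace F (μ k) ⊓ H.piece 0 1) = 0
    · left
      refine ⟨1, fun w hw => ?_⟩
      have hle : Module.End.eigenspace F (μ k) ⊓ H.piece 1 0 = Module.End.eigenspace F (μ k) :=
        Submodule.eq_of_le_of_finrank_eq inf_le_left (by have h := hrank k; rw [h01, add_zero] at h; rw [h, hfin])
      have hw10 : w ∈ H.piece 1 0 := by
        have : w ∈ Module.End.eigenspace F (μ k) ⊓ H.piece 1 0 := by rw [hle]; exact hw
        exact this.2
      rw [hΘ10 w hw10, one_smul]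
    · exact Or.inr (hX0 k h10 h01)
  -- `X_ℂ` commutes with `Θ`
  have hXΘ : X.baseChange ℂ * Θ = Θ * X.baseChange ℂ := by
    rw [← sub_eq_zero]
    refine CMThetaSocket.eq_zero_of_forall_eigenspace H rfl heff ψ hφE hE μ hinj hdist htop ?_ ?_ ?_
    · have h1 : Commute (X.baseChange ℂ) F := hXφ
      have h2 : Commute Θ F := hΘφ
      exact ((h1.mul_left h2).sub_left (h2.mul_left h1)).eq
    · intro x y
      simp only [LinearMap.sub_apply, Module.End.mul_apply, map_sub]
      have e1 := hXskewC (Θ x) y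
      have e2 := hΘskew x (X.baseChange ℂ y)
      have e3 := hΘskew (X.baseChange ℂ x) y
      have e4 := hXskewC x (Θ y)
      linear_combination e1 - e2 + e4 - e3
    · intro k w hw
      rw [LinearMap.sub_apply, Module.End.mul_apply, Module.End.mul_apply]
      rcases hblock k with ⟨ε, hε⟩ | h0
      · rw [hε w hw, map_smul, hε _ (hYW X hX𝔤 k w hw), sub_self]
      · rw [h0 w hw, map_zero, h0 _ (hΘW k w hw), sub_self]
  -- hence `X ∈ E`, `X` commutes with `𝔤`, and `X_ℂ` is a scalar on every block
  have hXE : X ∈ H.endAlg := mem_endAlg_of_commute_theta H hΘ hXΘ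
  have hXc : ∀ Y ∈ 𝔤, X.baseChange ℂ * Y.baseChange ℂ = Y.baseChange ℂ * X.baseChange ℂ := fun Y hY => by
    rw [← LinearMap.baseChange_mul, ← hcomm Y hY ⟨X, hXE⟩, LinearMap.baseChange_mul]
  have hscalar : ∀ k, ∀ w ∈ Module.End.eigenspace F (μ k), X.baseChange ℂ w = 0 := by
    intro k
    set W := Module.End.eigenspace F (μ k) with hWdef
    haveI : Nontrivial ↥W := Module.nontrivial_of_finrank_pos (R := ℂ) (by rw [hfin k]; exact Nat.pos_of_ne_zero hn₀)
    set Xk := (X.baseChange ℂ).restrict (hYW X hX𝔤 k) with hXk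
    obtain ⟨c, hc⟩ := Module.End.exists_eigenvalue Xk
    obtain ⟨v, hv⟩ := hc.exists_hasEigenvector
    have hvc : X.baseChange ℂ (v : ℂ ⊗[ℚ] V) = c • (v : ℂ ⊗[ℚ] V) := by
      have h := Module.End.mem_eigenspace_iff.1 hv.1
      have h' := congrArg Subtype.val h
      rwa [hXk, LinearMap.coe_restrict_apply, Submodule.coe_smul] at h'
    -- the `c`-eigenspace of `X_ℂ` in `W` is `𝔤`-stable and non-zero, hence all of `W`
    set U : Submodule ℂ (ℂ ⊗[ℚ] V) := W ⊓ Module.End.eigenspace (X.baseChange ℂ) c with hUdef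
    have hUst : ∀ Y ∈ 𝔤, ∀ u ∈ U, Y.baseChange ℂ u ∈ U := by
      intro Y hY u hu
      obtain ⟨huW, huc⟩ := Submodule.mem_inf.1 hu
      refine Submodule.mem_inf.2 ⟨hYW Y hY k u huW, Module.End.mem_eigenspace_iff.2 ?_⟩
      rw [← Module.End.mul_apply, hXc Y hY, Module.End.mul_apply, Module.End.mem_eigenspace_iff.1 huc, map_smul]
    have hUne : U ≠ ⊥ := by
      intro h
      have hvU : (v : ℂ ⊗[ℚ] V) ∈ U := Submodule.mem_inf.2 ⟨v.2, Module.End.mem_eigenspace_iff.2 hvc⟩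
      rw [h, Submodule.mem_bot] at hvU
      exact hv.2 (Subtype.ext hvU)
    have hUeq : U = W := ((hirr k U inf_le_left hUst).resolve_left hUne)
    have hcW : ∀ w ∈ W, X.baseChange ℂ w = c • w := fun w hw => by
      have : w ∈ U := by rw [hUeq]; exact hw
      exact Module.End.mem_eigenspace_iff.1 (Submodule.mem_inf.1 this).2
    -- its trace is `0` (as `X ∈ 𝔡`) and `n₀ c`
    have htr0 := CMDerived.trace_restrict_eq_zero (fun Y hY => hYW Y hY k) (baseChange_mem_spanC hX) (hYW X hX𝔤 k)
    have hre : (X.baseChange ℂ).restrict (hYW X hX𝔤 k) = c • (1 : Module.End ℂ ↥W) :=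
      LinearMap.ext fun w => Subtype.ext (by
        rw [LinearMap.coe_restrict_apply, LinearMap.smul_apply, Module.End.one_apply, Submodule.coe_smul, hcW _ w.2])
    rw [hre, map_smul, LinearMap.trace_one, hfin k, smul_eq_mul, mul_eq_zero] at htr0
    have hc0 : c = 0 := htr0.resolve_right (by exact_mod_cast hn₀)
    intro w hw
    rw [hcW w hw, hc0, zero_smul]
  have hX0C : X.baseChange ℂ = 0 :=
    CMThetaSocket.eq_zero_of_forall_eigenspace H rfl heff ψ hφE hE μ hinj hdist htop hXφ hXskewC hscalar
  exact CMDerived.eq_zero_of_baseChange hX0C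

/-! ### §3 Projections onto `𝔰𝔩(W)` for a `𝔤`-irreducible plane `W` -/

/-- **Every traceless endomorphism of a `𝔤`-irreducible `𝔤`-stable plane `W ⊆ V_ℂ` is induced by the complex DERIVED
span** of the bracket-closed `𝔤`: the relative plane theorem gives it in `𝔤_ℂ`; writing `Z = [h, ½(αe − βf)] + [γe, f]`
for an `𝔰𝔩₂`-triple `(e, f, h)` of `W` and lifting the four traceless operators to `𝔤_ℂ` moves `Z` into the span of
commutators. [cite: Humphreys1972, §4.1 and §2.1] [cite: MoonenZarhin1999LowDim, §2 (2.3)] -/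
theorem CMDerived.exists_mem_spanC_derived_forall_eq [Module.Finite ℚ V] (𝔤 : Submodule ℚ (Module.End ℚ V))
    (hbr : ∀ X ∈ 𝔤, ∀ X' ∈ 𝔤, X * X' - X' * X ∈ 𝔤) (W : Submodule ℂ (ℂ ⊗[ℚ] V))
    (hW2 : Module.finrank ℂ ↥W = 2) (hW : ∀ X ∈ 𝔤, ∀ w ∈ W, X.baseChange ℂ w ∈ W)
    (hirr : ∀ U ≤ W, (∀ X ∈ 𝔤, ∀ u ∈ U, X.baseChange ℂ u ∈ U) → U = ⊥ ∨ U = W)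
    (Z : Module.End ℂ ↥W) (hZ : LinearMap.trace ℂ _ Z = 0) :
    ∃ Y ∈ spanC (Submodule.span ℚ {B | ∃ X ∈ 𝔤, ∃ X' ∈ 𝔤, X * X' - X' * X = B}), ∀ w : ↥W, Y w = Z w := by
  classical
  -- the relative plane theorem for `𝔤_ℂ` on `W`
  have hSW : ∀ Y ∈ spanC 𝔤, ∀ w ∈ W, Y w ∈ W := fun Y hY w hw =>
    mapsTo_of_mem_spanC (T := W) (fun X hX => fun w hw => hW X hX w hw) hY hw
  have hbrC : ∀ Y ∈ spanC 𝔤, ∀ Y' ∈ spanC 𝔤, Y * Y' - Y' * Y ∈ spanC 𝔤 := fun Y hY Y' hY' =>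
    commutator_mem_spanC hbr hY hY'
  have hirrC : ∀ U ≤ W, (∀ Y ∈ spanC 𝔤, ∀ u ∈ U, Y u ∈ U) → U = ⊥ ∨ U = W := fun U hU hst =>
    hirr U hU fun X hX u hu => hst _ (baseChange_mem_spanC hX) u hu
  have hlift : ∀ T : Module.End ℂ ↥W, LinearMap.trace ℂ _ T = 0 → ∃ Y ∈ spanC 𝔤, ∀ w : ↥W, (T w : ℂ ⊗[ℚ] V) = Y w :=
    fun T hT => Literature.Algebra.Lie.exists_mem_forall_eq_of_trace_eq_zero W hW2 (spanC 𝔤) hbrC hSW hirrC hT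
  -- an `𝔰𝔩₂`-triple of `W`
  obtain ⟨bW⟩ : Nonempty (Module.Basis (Fin 2) ℂ ↥W) := ⟨Module.finBasisOfFinrankEq ℂ ↥W hW2⟩
  obtain ⟨e, he0, he1⟩ : ∃ e : Module.End ℂ ↥W, e (bW 0) = 0 ∧ e (bW 1) = bW 0 :=
    ⟨bW.constr ℂ ![(0 : ↥W), bW 0], by rw [Module.Basis.constr_basis]; rfl, by rw [Module.Basis.constr_basis]; rfl⟩
  obtain ⟨f, hf0, hf1⟩ : ∃ f : Module.End ℂ ↥W, f (bW 0) = bW 1 ∧ f (bW 1) = 0 :=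
    ⟨bW.constr ℂ ![bW 1, (0 : ↥W)], by rw [Module.Basis.constr_basis]; rfl, by rw [Module.Basis.constr_basis]; rfl⟩
  obtain ⟨h, hh0, hh1⟩ : ∃ h : Module.End ℂ ↥W, h (bW 0) = bW 0 ∧ h (bW 1) = -bW 1 :=
    ⟨bW.constr ℂ ![bW 0, -bW 1], by rw [Module.Basis.constr_basis]; rfl, by rw [Module.Basis.constr_basis]; rfl⟩
  have hr00 : bW.repr (bW 0) 0 = 1 := by rw [bW.repr_self, Finsupp.single_eq_same]
  have hr11 : bW.repr (bW 1) 1 = 1 := by rw [bW.repr_self, Finsupp.single_eq_same]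
  have hr01 : bW.repr (bW 0) 1 = 0 := by rw [bW.repr_self, Finsupp.single_apply, if_neg (by decide)]
  have hr10 : bW.repr (bW 1) 0 = 0 := by rw [bW.repr_self, Finsupp.single_apply, if_neg (by decide)]
  have htre : LinearMap.trace ℂ _ e = 0 := by
    rw [CMArith.trace_eq_sum_repr bW, Fin.sum_univ_two, he0, he1, LinearEquiv.map_zero, Finsupp.coe_zero,
      Pi.zero_apply, hr01, add_zero]
  have htrf : LinearMap.trace ℂ _ f = 0 := by
    rw [CMArith.trace_eq_sum_repr bW, Fin.sum_univ_two, hf0, hf1, LinearEquiv.map_zero, Finsupp.coe_zero,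
      Pi.zero_apply, hr10, add_zero]
  have htrh : LinearMap.trace ℂ _ h = 0 := by
    rw [CMArith.trace_eq_sum_repr bW, Fin.sum_univ_two, hh0, hh1, map_neg, Finsupp.neg_apply, hr00, hr11,
      add_neg_cancel]
  -- the coordinates of `Z`
  have hδ : bW.repr (Z (bW 1)) 1 = -bW.repr (Z (bW 0)) 0 := by
    rw [CMArith.trace_eq_sum_repr bW, Fin.sum_univ_two] at hZ
    linear_combination hZ
  have hZ0 : Z (bW 0) = bW.repr (Z (bW 0)) 0 • bW 0 + bW.repr (Z (bW 0)) 1 • bW 1 := by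
    conv_lhs => rw [← bW.sum_repr (Z (bW 0))]
    rw [Fin.sum_univ_two]
  have hZ1 : Z (bW 1) = bW.repr (Z (bW 1)) 0 • bW 0 + (-bW.repr (Z (bW 0)) 0) • bW 1 := by
    conv_lhs => rw [← bW.sum_repr (Z (bW 1))]
    rw [Fin.sum_univ_two, hδ]
  -- the two traceless partners
  set x : Module.End ℂ ↥W := (bW.repr (Z (bW 1)) 0 / 2) • e + (-(bW.repr (Z (bW 0)) 1 / 2)) • f with hxdef
  set y : Module.End ℂ ↥W := bW.repr (Z (bW 0)) 0 • e with hydef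
  have htrx : LinearMap.trace ℂ _ x = 0 := by
    rw [hxdef, map_add, map_smul, map_smul, htre, htrf, smul_zero, smul_zero, add_zero]
  have htry : LinearMap.trace ℂ _ y = 0 := by rw [hydef, map_smul, htre, smul_zero]
  -- `Z = [h, x] + [y, f]`, checked on the basis
  have key : Z = h * x - x * h + (y * f - f * y) := by
    refine bW.ext fun i => ?_
    fin_cases i
    · rw [Fin.zero_eta, hZ0]
      simp only [LinearMap.add_apply, LinearMap.sub_apply, Module.End.mul_apply, hxdef, hydef, LinearMap.smul_apply,
        he0, hf0, hh0, he1, hh1, smul_zero, zero_add, map_smul, map_zero]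
      module
    · rw [Fin.mk_one, hZ1]
      simp only [LinearMap.add_apply, LinearMap.sub_apply, Module.End.mul_apply, hxdef, hydef, LinearMap.smul_apply,
        hf0, hh0, he1, hf1, hh1, smul_zero, add_zero, map_smul, map_neg, map_zero]
      module
  have hZeq : ∀ w : ↥W, Z w = h (x w) - x (h w) + (y (f w) - f (y w)) := fun w => by rw [key]; rfl
  -- lift the four traceless operators and assemble
  obtain ⟨Yh, hYh, hYhw⟩ := hlift h htrh
  obtain ⟨Yx, hYx, hYxw⟩ := hlift x htrx
  obtain ⟨Yy, hYy, hYyw⟩ := hlift y htry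
  obtain ⟨Yf, hYf, hYfw⟩ := hlift f htrf
  refine ⟨Yh * Yx - Yx * Yh + (Yy * Yf - Yf * Yy),
    Submodule.add_mem _ (commutator_mem_spanC_derived hYh hYx) (commutator_mem_spanC_derived hYy hYf), fun w => ?_⟩
  rw [hZeq w, Submodule.coe_add, Submodule.coe_sub, Submodule.coe_sub]
  simp only [hYhw, hYxw, hYyw, hYfw, LinearMap.add_apply, LinearMap.sub_apply, Module.End.mul_apply]

end HodgeStructure

end Literature.AlgebraicGeometry.Motives
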